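import Mathlib
import HarnessLib
import Literature.Computability.AlgebraicComplexity.AsymptoticSpectrum
import Literature.Computability.AlgebraicComplexity.BorderRankCW
import Summits.MatrixMultiplication.MatrixMultiplication.Theorems.OutsiderSandwichToricCeiling
import Summits.MatrixMultiplication.MatrixMultiplication.Theorems.OutsiderSandwichToricCeilingPowFibres
import Summits.MatrixMultiplication.MatrixMultiplication.Theorems.OutsiderSandwichToricCeilingPow

/-!
# OutsiderSandwich — toric ceiling of `cw₂^{⊠N}`, part 3: no monomial certificate of `⟨r⟩` from
`cw₂^{⊠N}` has `r ≥ 3^N - 1` (`N ≥ 2`, every product basis)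
(decomp-mm lens 4, gen 43, kernel K43-4c; THESES-FREE, `ω`-free; helper toward `LaserTangency`,
stmt-32268)

WHAT.  Part 2 (`…ToricCeilingPow.productFrame_no_diagonal_comb_degeneration`) bounds diagonal
combinatorial degenerations of the product frames of `cw₂^{⊠N}` by `3^N - 2`.  Here it is restated
as a NO-GO on the verbatim hypotheses `h₁/h₂` of `isApproxRestriction_of_monomial`
(`OutsiderSandwichBorderSubrankTwenty`) — leg maps `σ : Fin r → Word N` and `ℕ`-weights with
"weight `< K` ⇒ host entry `0`" and "weight-`K` layer `= ⟨r⟩`" — for the host written in ANY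
product basis: `patternHost F κ D a b c = ∏ᵢ (cw₂ or D)(aᵢ, bᵢ, cᵢ)` with `D a b c = [a, b, c
pairwise distinct]` the diagonalised `cw₂` (`D ≅ cw₂` over `ℂ`); for `κ ≡ true` this is literally
`kroneckerPow (cwTensor F 2) N`, the host of `LaserTangency`.

* `le_of_frame_certificate`: frame-level reduction (leg maps forced injective, image diagonal,
  weights `α ∘ σA⁻¹`, `β ∘ σB⁻¹` (`K+1` off the image), `γ ∘ σC⁻¹ - K` (`1` off the image));
* `patternHost_apply`, `kroneckerPow_cwTensor_eq_patternHost`: the hosts are the indicator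
  functions of the product frames;
* `patternHost_monomial_certificate_le`, `cwPow_monomial_certificate_le` (`r + 2 ≤ 3^N`),
  `cwPow_three_monomial_certificate_le_twentyFive`.

HONEST SCOPE.  Toric certificates only (the laser method's currency and the tree's K42-e/g/h);
`AlgDegeneratesTo (kroneckerPow (cwTensor ℂ 2) N) (unitTensor ℂ (3^N - 1))` by a non-monomial
degeneration is not excluded (`⟨3^N⟩` is, K42-f).
-/

set_option linter.dupNamespace false

namespace Summit.MatrixMultiplication.MatrixMultiplication.Theorems.OutsiderSandwichToricCeilingPowMonomial

open Finset
open Literature.Computability.AlgebraicComplexity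
open Summit.MatrixMultiplication.MatrixMultiplication.Theorems.OutsiderSandwichToricCeiling
  (cwSlot dSlot)
open Summit.MatrixMultiplication.MatrixMultiplication.Theorems.OutsiderSandwichToricCeilingPowFibres
open Summit.MatrixMultiplication.MatrixMultiplication.Theorems.OutsiderSandwichToricCeilingPow

variable {N : ℕ}

/-! ## §1 Frame-level reduction -/

/-- FRAME-LEVEL REDUCTION.  If no diagonal `Ψ ⊆ Φ` with `#Ψ + 1 ≥ B` is a combinatorial
degeneration (integer weights), and leg maps `τ : Fin r → Word N` with `ℕ`-weights satisfy "weight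
`< K` ⇒ outside `Φ`" and "inside `Φ` with weight `= K` ⇔ diagonal", then `r + 2 ≤ B`. [new] -/
theorem le_of_frame_certificate (B : ℕ) {Φ : Finset (Tr3 N)}
    (nobig : ∀ (Ψ : Finset (Tr3 N)) (a b c : Word N → ℤ), Ψ ⊆ Φ →
      (∀ t ∈ Ψ, a t.1 + b t.2.1 + c t.2.2 = 0) → (∀ t ∈ Φ, t ∉ Ψ → 1 ≤ a t.1 + b t.2.1 + c t.2.2) →
      (∀ t ∈ Ψ, ∀ t' ∈ Ψ, (t.1 = t'.1 ∨ t.2.1 = t'.2.1 ∨ t.2.2 = t'.2.2) → t = t') →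
      B ≤ #Ψ + 1 → False)
    {r K : ℕ} (τA τB τC : Fin r → Word N) (α β γ : Fin r → ℕ)
    (h₁ : ∀ x y z, α x + β y + γ z < K → (τA x, τB y, τC z) ∉ Φ)
    (h₂ : ∀ x y z, ((τA x, τB y, τC z) ∈ Φ ∧ α x + β y + γ z = K) ↔ (x = y ∧ y = z)) : r + 2 ≤ B := by
  have diag : ∀ x, (τA x, τB x, τC x) ∈ Φ ∧ α x + β x + γ x = K := fun x => (h₂ x x x).2 ⟨rfl, rfl⟩
  -- the three leg maps are injective
  have iA : Function.Injective τA := by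
    intro x x' e
    rcases Nat.lt_trichotomy (α x' + β x + γ x) K with hlt | heq | hgt
    · exact absurd (e ▸ (diag x).1 : (τA x', τB x, τC x) ∈ Φ) (h₁ x' x x hlt)
    · exact ((h₂ x' x x).1 ⟨by rw [← e]; exact (diag x).1, heq⟩).1.symm
    · have := (diag x).2; have := (diag x').2
      exact absurd (e.symm ▸ (diag x').1 : (τA x, τB x', τC x') ∈ Φ) (h₁ x x' x' (by omega))
  have iB : Function.Injective τB := by
    intro y y' e
    rcases Nat.lt_trichotomy (α y + β y' + γ y) K with hlt | heq | hgt
    · exact absurd (e ▸ (diag y).1 : (τA y, τB y', τC y) ∈ Φ) (h₁ y y' y hlt)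
    · exact ((h₂ y y' y).1 ⟨by rw [← e]; exact (diag y).1, heq⟩).1
    · have := (diag y).2; have := (diag y').2
      exact absurd (e.symm ▸ (diag y').1 : (τA y', τB y, τC y') ∈ Φ) (h₁ y' y y' (by omega))
  have iC : Function.Injective τC := by
    intro z z' e
    rcases Nat.lt_trichotomy (α z + β z + γ z') K with hlt | heq | hgt
    · exact absurd (e ▸ (diag z).1 : (τA z, τB z, τC z') ∈ Φ) (h₁ z z z' hlt)
    · exact ((h₂ z z z').1 ⟨by rw [← e]; exact (diag z).1, heq⟩).2
    · have := (diag z).2; have := (diag z').2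
      exact absurd (e.symm ▸ (diag z').1 : (τA z', τB z', τC z) ∈ Φ) (h₁ z' z' z (by omega))
  -- the diagonal of image triples
  set T : Fin r → Tr3 N := fun x => (τA x, τB x, τC x) with hT
  have iT : Function.Injective T := fun x x' e => iA (congrArg Prod.fst e)
  set Ψ : Finset (Tr3 N) := univ.image T with hΨ
  have memΨ : ∀ {t}, t ∈ Ψ ↔ ∃ x, T x = t := by
    intro t; simp [hΨ]
  have hcard : #Ψ = r := by
    rw [hΨ, Finset.card_image_of_injective _ iT, Finset.card_univ, Fintype.card_fin]
  have hsub : Ψ ⊆ Φ := fun t ht => by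
    obtain ⟨x, rfl⟩ := memΨ.mp ht; exact (diag x).1
  have hdiag : ∀ t ∈ Ψ, ∀ t' ∈ Ψ, (t.1 = t'.1 ∨ t.2.1 = t'.2.1 ∨ t.2.2 = t'.2.2) → t = t' := by
    intro t ht t' ht' hlegs
    obtain ⟨x, rfl⟩ := memΨ.mp ht
    obtain ⟨x', rfl⟩ := memΨ.mp ht'
    rcases hlegs with e | e | e
    · rw [iA e]
    · rw [iB e]
    · rw [iC e]
  -- the weights (defined by extension along the injective leg maps)
  obtain ⟨a, ha, a_off⟩ : ∃ a : Word N → ℤ, (∀ x, a (τA x) = α x) ∧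
      ∀ u, (¬ ∃ x, τA x = u) → a u = K + 1 :=
    ⟨Function.extend τA (fun x => (α x : ℤ)) fun _ => (K : ℤ) + 1,
      fun x => iA.extend_apply _ _ x, fun u h => Function.extend_apply' _ _ u h⟩
  obtain ⟨b, hb, b_off⟩ : ∃ b : Word N → ℤ, (∀ y, b (τB y) = β y) ∧
      ∀ v, (¬ ∃ y, τB y = v) → b v = K + 1 :=
    ⟨Function.extend τB (fun y => (β y : ℤ)) fun _ => (K : ℤ) + 1,
      fun y => iB.extend_apply _ _ y, fun v h => Function.extend_apply' _ _ v h⟩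
  obtain ⟨c, hc, c_off⟩ : ∃ c : Word N → ℤ, (∀ z, c (τC z) = (γ z : ℤ) - K) ∧
      ∀ w, (¬ ∃ z, τC z = w) → c w = 1 :=
    ⟨Function.extend τC (fun z => (γ z : ℤ) - K) fun _ => 1,
      fun z => iC.extend_apply _ _ z, fun w h => Function.extend_apply' _ _ w h⟩
  have a_nonneg : ∀ u, 0 ≤ a u := fun u => by
    by_cases h : ∃ x, τA x = u
    · obtain ⟨x, rfl⟩ := h; rw [ha]; positivity
    · rw [a_off u h]; positivity
  have b_nonneg : ∀ v, 0 ≤ b v := fun v => by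
    by_cases h : ∃ y, τB y = v
    · obtain ⟨y, rfl⟩ := h; rw [hb]; positivity
    · rw [b_off v h]; positivity
  have c_ge : ∀ w, -(K : ℤ) ≤ c w := fun w => by
    by_cases h : ∃ z, τC z = w
    · obtain ⟨z, rfl⟩ := h; rw [hc]; linarith [(γ z).cast_nonneg (α := ℤ)]
    · rw [c_off w h]; omega
  -- `E = 0` on `Ψ`, `E ≥ 1` on `Φ ∖ Ψ`
  have hzero : ∀ t ∈ Ψ, a t.1 + b t.2.1 + c t.2.2 = 0 := fun t ht => by
    obtain ⟨x, rfl⟩ := memΨ.mp ht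
    simp only [hT, ha, hb, hc]; have := (diag x).2; omega
  have hone : ∀ t ∈ Φ, t ∉ Ψ → 1 ≤ a t.1 + b t.2.1 + c t.2.2 := by
    rintro ⟨u, v, w⟩ ht hn
    by_cases hu : ∃ x, τA x = u
    · obtain ⟨x, rfl⟩ := hu
      by_cases hv : ∃ y, τB y = v
      · obtain ⟨y, rfl⟩ := hv
        by_cases hw : ∃ z, τC z = w
        · obtain ⟨z, rfl⟩ := hw
          simp only [ha, hb, hc]
          have hne : α x + β y + γ z ≠ K := fun heq => by
            obtain ⟨rfl, rfl⟩ := (h₂ x y z).1 ⟨ht, heq⟩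
            exact hn (memΨ.mpr ⟨x, rfl⟩)
          have hge : ¬ α x + β y + γ z < K := fun hlt => h₁ x y z hlt ht
          omega
        · simp only [ha, hb, c_off w hw]; omega
      · rw [b_off v hv]; linarith [a_nonneg (τA x), c_ge w]
    · rw [a_off u hu]; linarith [b_nonneg v, c_ge w]
  by_contra hr
  exact nobig Ψ a b c hsub hzero hone hdiag (by omega)


/-! ## §2 The hosts are indicator functions of the product frames -/

/-- The host written in the product basis `κ`: coordinate `i` is `cw₂` (cw basis) if `κ i`, else the
diagonalised copy `D`. [new] -/
def patternHost (F : Type) [Field F] (κ : Fin N → Bool) (D : Fin 3 → Fin 3 → Fin 3 → F) :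
    Word N → Word N → Word N → F :=
  fun a b c => ∏ i, if κ i then cwTensor F 2 (a i) (b i) (c i) else D (a i) (b i) (c i)

/-- One factor is the indicator of its slot pattern. [new] -/
theorem factor_eq_slot (F : Type) [Field F] {D : Fin 3 → Fin 3 → Fin 3 → F}
    (hD : ∀ a b c, D a b c = if a ≠ b ∧ b ≠ c ∧ a ≠ c then 1 else 0) (b : Bool) (x y z : Fin 3) :
    (if b then cwTensor F 2 x y z else D x y z) = if slotB b x y z = true then 1 else 0 := by
  cases b
  · rw [hD]; simp [slotB, dSlot]
  · rw [cwTensor_apply]; simp [slotB, cwSlot]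

/-- The pattern host is the indicator function of the product frame. [new] -/
theorem patternHost_apply (F : Type) [Field F] (κ : Fin N → Bool) {D : Fin 3 → Fin 3 → Fin 3 → F}
    (hD : ∀ a b c, D a b c = if a ≠ b ∧ b ≠ c ∧ a ≠ c then 1 else 0) (a b c : Word N) :
    patternHost F κ D a b c = if (a, b, c) ∈ frame κ then 1 else 0 := by
  unfold patternHost
  rw [Finset.prod_congr rfl fun i _ => factor_eq_slot F hD (κ i) (a i) (b i) (c i),
    Finset.prod_boole]
  simp [frame]

/-- In the all-cw basis the pattern host is literally `kroneckerPow (cwTensor F 2) N`. [new] -/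
theorem kroneckerPow_cwTensor_eq_patternHost (F : Type) [Field F]
    (D : Fin 3 → Fin 3 → Fin 3 → F) (a b c : Word N) :
    kroneckerPow (cwTensor F 2) N a b c = patternHost F (fun _ => true) D a b c := by
  rw [kroneckerPow_apply]; simp [patternHost]

/-! ## §3 The no-go theorems -/

/-- **No monomial certificate of `⟨r⟩` from `cw₂^{⊠N}` in a product basis has `r ≥ 3^N - 1`**
(`N ≥ 2`): on the verbatim hypotheses of `isApproxRestriction_of_monomial` for the host
`patternHost F κ D` and the target `unitTensor F r`, `r + 2 ≤ 3^N`. [new] -/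
theorem patternHost_monomial_certificate_le (F : Type) [Field F] (hN : 2 ≤ N) (κ : Fin N → Bool)
    {D : Fin 3 → Fin 3 → Fin 3 → F} (hD : ∀ a b c, D a b c = if a ≠ b ∧ b ≠ c ∧ a ≠ c then 1 else 0)
    {r K : ℕ} (σA σB σC : Fin r → Word N) (α β γ : Fin r → ℕ)
    (h₁ : ∀ x y z, α x + β y + γ z < K → patternHost F κ D (σA x) (σB y) (σC z) = 0)
    (h₂ : ∀ x y z, (if α x + β y + γ z = K then patternHost F κ D (σA x) (σB y) (σC z) else 0) =
      unitTensor F r x y z) : r + 2 ≤ 3 ^ N := by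
  refine le_of_frame_certificate (3 ^ N) (Φ := frame κ) (K := K)
    (fun Ψ a b c hs hz ho hd hb =>
      productFrame_no_diagonal_comb_degeneration hN κ hs hz ho hd hb)
    σA σB σC α β γ (fun x y z hlt hmem => ?_) (fun x y z => ?_)
  · have h := h₁ x y z hlt
    rw [patternHost_apply F κ hD, if_pos hmem] at h
    exact one_ne_zero h
  · have h := h₂ x y z
    rw [patternHost_apply F κ hD, unitTensor_apply] at h
    constructor
    · rintro ⟨hmem, heq⟩
      rw [if_pos heq, if_pos hmem] at h
      by_contra hne; rw [if_neg hne] at h; exact one_ne_zero h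
    · rintro ⟨rfl, rfl⟩
      rw [if_pos (show x = x ∧ x = x from ⟨rfl, rfl⟩)] at h
      by_cases heq : α x + β x + γ x = K
      · rw [if_pos heq] at h
        by_cases hmem : (σA x, σB x, σC x) ∈ frame κ
        · exact ⟨hmem, heq⟩
        · rw [if_neg hmem] at h; exact absurd h zero_ne_one
      · rw [if_neg heq] at h; exact absurd h zero_ne_one

/-- **The literal host of `LaserTangency`**: no monomial certificate of `⟨r⟩` from
`kroneckerPow (cwTensor F 2) N` (`N ≥ 2`) has `r ≥ 3^N - 1`. [new] -/
theorem cwPow_monomial_certificate_le (F : Type) [Field F] (hN : 2 ≤ N)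
    {r K : ℕ} (σA σB σC : Fin r → Word N) (α β γ : Fin r → ℕ)
    (h₁ : ∀ x y z, α x + β y + γ z < K → kroneckerPow (cwTensor F 2) N (σA x) (σB y) (σC z) = 0)
    (h₂ : ∀ x y z, (if α x + β y + γ z = K then kroneckerPow (cwTensor F 2) N (σA x) (σB y) (σC z)
      else 0) = unitTensor F r x y z) : r + 2 ≤ 3 ^ N := by
  let D : Fin 3 → Fin 3 → Fin 3 → F := fun a b c => if a ≠ b ∧ b ≠ c ∧ a ≠ c then 1 else 0
  refine patternHost_monomial_certificate_le F hN (fun _ => true) (D := D) (fun _ _ _ => rfl)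
    (K := K) σA σB σC α β γ (fun x y z hlt => ?_) (fun x y z => ?_)
  · rw [← kroneckerPow_cwTensor_eq_patternHost]; exact h₁ x y z hlt
  · rw [← kroneckerPow_cwTensor_eq_patternHost]; exact h₂ x y z
/-- `N = 3`: every monomial certificate `⟨r⟩ ⊴ cw₂^{⊠3}` has `r ≤ 25` (the tree has `r = 21`,
K42-h `unitTensor_twentyOne_deg_cwTwoPow_three`). [new] -/
theorem cwPow_three_monomial_certificate_le_twentyFive (F : Type) [Field F]
    {r K : ℕ} (σA σB σC : Fin r → Word 3) (α β γ : Fin r → ℕ)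
    (h₁ : ∀ x y z, α x + β y + γ z < K → kroneckerPow (cwTensor F 2) 3 (σA x) (σB y) (σC z) = 0)
    (h₂ : ∀ x y z, (if α x + β y + γ z = K then kroneckerPow (cwTensor F 2) 3 (σA x) (σB y) (σC z)
      else 0) = unitTensor F r x y z) : r ≤ 25 := by
  have := cwPow_monomial_certificate_le F (by norm_num) σA σB σC α β γ h₁ h₂
  norm_num at this; omega

end Summit.MatrixMultiplication.MatrixMultiplication.Theorems.OutsiderSandwichToricCeilingPowMonomial
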